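import Summits.BirchSwinnertonDyer.Rank1Residual.Additive.RamifiedSevenGenusKatoSideLevelIdentity
import Literature.NumberTheory.EllipticCurves.PastenHeightBoundsIsogenyProofs
import Literature.NumberTheory.EllipticCurves.NeronIsogenyScalingHoldsProofs
import Literature.NumberTheory.EllipticCurves.RealLatticePeriodDiscrProofs
import Literature.NumberTheory.EllipticCurves.BSDQuadraticDescentArchimedeanProofs
import Literature.NumberTheory.EllipticCurves.ComplexMultiplicationSingularModuli
import Literature.NumberTheory.ComplexMultiplication.EllipticUnits.CMLatticeOverHilbertClassNumberOne
import HarnessLib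

set_option autoImplicit false

/-!
# `𝒞₇` genus road (crux `EllipticUnitValueSevenOfGZK` = stmt-BirchSwinnertonDyer-19945, K7r): (S-P) = LEMMA P, part 1/3 —
# Néron-lattice scalings of `ℚ`-isogenies, the `7`-free real-period ratio, and the CM field block `Λ₋₇ = ι₀(𝓞 Kcm)`

Cell bsd-cm, seat bsd-cm-k-ty1 g37 (literature-prover, explicit unit, claim-free); pen bsd-cm-plan g40 (P-2) brief `g40/SP-BRIEF.md`
27a7727cca63174d, ruling D1186 (c); critic idea-crit-15 g19 NOTE #47 (B).  Part 1 of the three-file (≤ 400 lines each) split of the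
one-file farm witness `g37/RamifiedSevenGenusLatticeTypeLaw.asannounced.lean` 59f5eded6fee373f; part 3
(`RamifiedSevenGenusLatticeTypeLaw.lean`) carries the letter `GenusSeven.latticeTypeLawSeven` and the full proof map.

CONTENTS (namespace `GenusSeven.LatticeTypeLaw`; PURE KERNEL, theorems only):
* §1 the Néron lattice `L` of a model `W/ℚ` (`IsNeronLatticeOf (W.baseChange ℂ) L`): `g₂ = c₄(W_ℝ)/12`, `g₃ = c₆(W_ℝ)/216` as real casts,
  `isReal_neron`, `realPeriodRat_eq : Ω(W) = n_W·Ω₀(L)`, `v₇(n_W) = 0` (`n_W ∈ {1,2}`);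
* §2 `exists_int_scaling`: a `ℚ`-isogeny `φ : W → W'` of GLOBALLY MINIMAL curves scales the Néron lattices by `k ∈ ℤ ∖ 0`, `k ∣ deg φ`,
  `kΛ_W ⊆ Λ_{W'}` (`exists_rat_mulLeft_lattice_le_of_isogeny` + `integral_neronScaling_of_isGloballyMinimal_holds` twice — the bookkeeping
  of `SkinnerUrban2014.exists_int_mul_minRealPeriod_eq_of_isogeny` over `IsNeronLatticeOf` binders); `not_seven_dvd_degree`:
  `ψ ∘ φ = [e]`, `e ∈ {1,2}` ⇒ `7 ∤ deg φ` (Cauchy on `ker φ ⊆ W[e]`);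
* §3 `exists_realPeriodRat_ratio`: for an isogeny PAIR `(φ₀, ψ₀)` with `ψ₀φ₀ = [e] = φ₀ψ₀`, `e ∈ {1,2}`, between globally minimal models,
  `∃ r ∈ ℚ, r·Ω(W) = Ω(W₂) ∧ v₇(r) = 0` (`kΩ₀ = aΩ₀₂`, `k'Ω₀₂ = bΩ₀`, `ab = kk'`, `7 ∤ kk'`, `r = n₂k/(n_W a)`) — no CM input;
* §4 the CM field block for `[Kcm : ℚ] = 2`, `s² = −7`, `ι₀ : Kcm → ℂ`: `cmRing(−7) = ι₀(𝓞 Kcm)` (`exists_forall_mem_cmRing_discr_iff`,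
  `d_K = −7`), `mem_lattice_iff_of_eq_mulLeft : z ∈ Ω·Λ₋₇ ↔ ∃ a : 𝓞 Kcm, z = Ω·ι₀ a`, `v₇(N s) = 1`, `v₇(N a) ≥ 0` (`a ∈ 𝓞 Kcm`).

HONEST LABEL: helper theorems only (no `def`, no named fact, no `instance`, no notation, no `sorry`); nothing of the line of record is touched; stmt-BirchSwinnertonDyer-19945 stays OPEN (zp v24 df4123daf56b4e4d, 4 sorries); `X12.CMRamifiedSeven` is NOT proved; no summit statement is proved by this seat; BSD is claimed for no curve.

## References
* J. H. Silverman, *AEC* (2009), III.4.10, III.6.1, Thm. VI.4.1 (b), Thm. VI.5.1, C.16; *ATAEC* (1994), IV.5.1, IV.6.1, Cor. IV.9.1. [SilvermanAEC2009] [SilvermanATAEC1994]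
* J. E. Cremona, *Algorithms for Modular Elliptic Curves* (1997), §3.7. [CremonaAlgorithms1997]
* D. A. Cox, *Primes of the form x² + ny²*, 2nd ed. (2013), §5.B (5.14), §7.A (7.1). [Cox2013]
* J. Coates, A. Wiles, Invent. Math. 39 (1977), §1 p. 225. [CoatesWiles1977]
* Tree: `PastenHeightBoundsIsogenyProofs`, `NeronIsogenyScalingHoldsProofs`, `RealLatticePeriodDiscrProofs`, `BSDQuadraticDescentArchimedeanProofs`,
  `SkinnerUrban2014/PAdicUnitPeriodRatioProofs` (template), `ComplexMultiplicationSingularModuli`, `EllipticUnits/CMLatticeOverHilbertClassNumberOne`,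
  `RamifiedSevenGenusNormedFamilyFields`, `RamifiedSevenGenusKatoSideLevelIdentity`.
-/

noncomputable section

open scoped NumberField
open WeierstrassCurve
open Literature.NumberTheory.EllipticCurves
open Literature.NumberTheory.EllipticCurves.ModularForms
open Literature.NumberTheory.ComplexMultiplication.EllipticUnits

namespace Summit.BirchSwinnertonDyer.Rank1Residual.Additive.GenusSeven

namespace LatticeTypeLaw

/-! ## §1 The Néron lattice of a model over `ℚ`: real invariants, reality, the real period -/

/-- `g₂(Λ_W) = c₄(W_ℝ)/12` as a real number cast to `ℂ`. [cite: SilvermanAEC2009, Thm. VI.5.1] -/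
theorem neron_g₂_ofReal {W : WeierstrassCurve ℚ} {L : PeriodPair} (hL : IsNeronLatticeOf (W.baseChange ℂ) L) :
    L.g₂ = (((W.baseChange ℝ).c₄ / 12 : ℝ) : ℂ) := by
  rw [hL.1]
  simp only [WeierstrassCurve.baseChange, WeierstrassCurve.map_c₄, eq_ratCast, Complex.ofReal_div,
    Complex.ofReal_ratCast, Complex.ofReal_ofNat]

/-- `g₃(Λ_W) = c₆(W_ℝ)/216` as a real number cast to `ℂ`. [cite: SilvermanAEC2009, Thm. VI.5.1] -/
theorem neron_g₃_ofReal {W : WeierstrassCurve ℚ} {L : PeriodPair} (hL : IsNeronLatticeOf (W.baseChange ℂ) L) :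
    L.g₃ = (((W.baseChange ℝ).c₆ / 216 : ℝ) : ℂ) := by
  rw [hL.2]
  simp only [WeierstrassCurve.baseChange, WeierstrassCurve.map_c₆, eq_ratCast, Complex.ofReal_div,
    Complex.ofReal_ratCast, Complex.ofReal_ofNat]

/-- **`Λ_W` is a real lattice** (real invariants; uniqueness half of the Uniformization Theorem).
[cite: SilvermanAEC2009, Thm. VI.5.1 (uniqueness) and Cor. VI.5.1.1] -/
theorem isReal_neron {W : WeierstrassCurve ℚ} {L : PeriodPair} (hL : IsNeronLatticeOf (W.baseChange ℂ) L) : L.IsReal :=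
  WeierstrassCurve.isReal_of_g₂_eq_of_g₃_eq (W.baseChange ℝ) (neron_g₂_ofReal hL) (neron_g₃_ofReal hL)

/-- **`Ω(W) = n_W · Ω₀(Λ_W)`**: the real period of the model is the number of real components times the least positive real
period of its Néron lattice. [cite: SilvermanAEC2009, C.16] [cite: CremonaAlgorithms1997, §3.7] -/
theorem realPeriodRat_eq {W : WeierstrassCurve ℚ} [W.IsElliptic] {L : PeriodPair} (hL : IsNeronLatticeOf (W.baseChange ℂ) L) :
    W.realPeriodRat = (W.baseChange ℝ).numRealComponents * L.minRealPeriod := by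
  haveI : (W.baseChange ℝ).IsElliptic := by rw [WeierstrassCurve.baseChange]; infer_instance
  rw [WeierstrassCurve.realPeriodRat_def]
  exact (W.baseChange ℝ).realPeriod_eq_numRealComponents_mul_minRealPeriod (neron_g₂_ofReal hL) (neron_g₃_ofReal hL)

/-- `v₇(n_W) = 0` (`n_W ∈ {1, 2}`; cf. `Additive.numRealComponents_eq_one_or_two`). [cite: CremonaAlgorithms1997, §3.7] -/
theorem padicValRat_numRealComponents (V : WeierstrassCurve ℝ) : padicValRat 7 (V.numRealComponents : ℚ) = 0 := by
  have h : padicValNat 7 V.numRealComponents = 0 := by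
    unfold WeierstrassCurve.numRealComponents
    split_ifs
    · exact padicValNat.eq_zero_of_not_dvd (by norm_num)
    · simp
  rw [padicValRat.of_nat, h, Nat.cast_zero]

/-! ## §2 The integer scaling of a `ℚ`-isogeny between globally minimal models; `7 ∤ deg` when `ψ ∘ φ = [e]`, `e ∣ 2` -/

/-- **Integer scaling**: a `ℚ`-isogeny `φ : W → W'` of GLOBALLY MINIMAL elliptic curves acts on the Néron lattices as `z ↦ kz` with
`k ∈ ℤ ∖ 0`, `k ∣ deg φ` and `kΛ_W ⊆ Λ_{W'}` (Silverman AEC VI.4.1 (b) + rationality of the multiplier + integrality of the Néron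
scaling of globally minimal models, `integral_neronScaling_of_isGloballyMinimal_holds`, applied to `k` and to `deg φ / k`; the
bookkeeping of `SkinnerUrban2014.exists_int_mul_minRealPeriod_eq_of_isogeny`).
[cite: SilvermanAEC2009, Thm. VI.4.1 (b)] [cite: SilvermanATAEC1994, IV.5.1 with IV.6.1 and Cor. IV.9.1] -/
theorem exists_int_scaling {W W' : WeierstrassCurve ℚ} [W.IsElliptic] [W'.IsElliptic] [W.IsGloballyMinimal]
    [W'.IsGloballyMinimal] {L L' : PeriodPair} (hL : IsNeronLatticeOf (W.baseChange ℂ) L)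
    (hL' : IsNeronLatticeOf (W'.baseChange ℂ) L') (φ : Isogeny W W') :
    ∃ k : ℤ, k ≠ 0 ∧ k ∣ (φ.degree : ℤ) ∧ ∀ z ∈ L.lattice, (k : ℂ) * z ∈ L'.lattice := by
  obtain ⟨r, hr0, hle, hidx⟩ := exists_rat_mulLeft_lattice_le_of_isogeny W W' hL hL' φ
  set d : ℕ := φ.degree with hd
  have hr0' : (r : ℚ) ≠ 0 := by
    rintro rfl
    exact hr0 (by push_cast; rfl)
  have hmem : ∀ z ∈ L.lattice, ((r : ℚ) : ℂ) * z ∈ L'.lattice := fun z hz ↦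
    hle (PeriodPair.mul_mem_mulLeft_lattice.mpr hz)
  obtain ⟨q, hq⟩ := integral_neronScaling_of_isGloballyMinimal_holds W W' L L' hL hL' r hmem
  have hdmem : ∀ z ∈ L'.lattice, ((d / r : ℚ) : ℂ) * z ∈ L.lattice := by
    intro z hz
    have h1 : d • z ∈ (L.mulLeft (r : ℂ) hr0).lattice := by
      have h2 := AddSubgroup.nsmul_relIndex_mem (L.mulLeft (r : ℂ) hr0).lattice.toAddSubgroup
        (K := L'.lattice.toAddSubgroup) (g := z) hz
      rw [hidx] at h2
      exact h2
    rw [PeriodPair.mem_mulLeft_lattice, nsmul_eq_mul] at h1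
    have e : ((d / r : ℚ) : ℂ) * z = ((r : ℚ) : ℂ)⁻¹ * ((d : ℂ) * z) := by
      push_cast
      ring
    rw [e]
    exact h1
  obtain ⟨q', hq'⟩ := integral_neronScaling_of_isGloballyMinimal_holds W' W L' L hL' hL (d / r) hdmem
  have hqq' : q * q' = d := by
    have h : (q : ℚ) * q' = d := by
      rw [hq, hq']
      field_simp
    exact_mod_cast h
  refine ⟨q, ?_, ⟨q', hqq'.symm⟩, fun z hz ↦ ?_⟩
  · rintro rfl
    apply hr0'
    exact_mod_cast hq.symm
  · have h := hmem z hz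
    rw [← hq] at h
    push_cast at h
    exact h

/-- **`7 ∤ deg φ`** when `ψ ∘ φ = [e]` with `e ∈ {1, 2}`: `ker φ ⊆ W[e]`, and an element of order `7` in `ker φ` (Cauchy) would have
order dividing `e`. [cite: SilvermanAEC2009, III.4.10 (c) and Thm. III.6.1 (a)] -/
theorem not_seven_dvd_degree {W W' : WeierstrassCurve ℚ} (φ : Isogeny W W') (ψ : Isogeny W' W) {e : ℤ} (he : e = 1 ∨ e = 2)
    (h : ∀ P, ψ (φ P) = e • P) : ¬ (7 : ℤ) ∣ (φ.degree : ℤ) := by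
  intro h7
  have h7' : 7 ∣ φ.degree := by exact_mod_cast h7
  haveI : Fact (Nat.Prime 7) := ⟨by norm_num⟩
  obtain ⟨x, hx⟩ := exists_prime_addOrderOf_dvd_card' (G := φ.toAddMonoidHom.ker) 7 h7'
  have hxker : φ (x : W.geomPoints) = 0 := by
    have hx2 := x.2
    rw [AddMonoidHom.mem_ker] at hx2
    exact hx2
  have hsmul : e • (x : W.geomPoints) = 0 := by rw [← h, hxker, map_zero]
  have hdvd : (addOrderOf (x : W.geomPoints) : ℤ) ∣ e := addOrderOf_dvd_iff_zsmul_eq_zero.mpr hsmul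
  rw [AddSubgroup.addOrderOf_coe, hx] at hdvd
  rcases he with rfl | rfl <;> omega

/-- `7` is prime in `ℤ`. [folklore] -/
theorem prime_seven_int : Prime (7 : ℤ) := Int.prime_iff_natAbs_prime.mpr (by norm_num)

/-! ## §3 The real-period ratio of a pair of globally minimal curves linked by `(φ₀, ψ₀)` with `ψ₀ ∘ φ₀ = [e]`, `e ∣ 2`: `v₇(r) = 0` -/

/-- **The real-period ratio is a `7`-adic unit.**  For GLOBALLY MINIMAL elliptic curves `W, W₂/ℚ` with `ℚ`-isogenies
`φ₀ : W → W₂`, `ψ₀ : W₂ → W`, `ψ₀ ∘ φ₀ = [e]`, `φ₀ ∘ ψ₀ = [e]`, `e ∈ {1, 2}`: there is `r ∈ ℚ` with `r·Ω(W) = Ω(W₂)` and `v₇(r) = 0`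
(`kΩ₀ = aΩ₀'`, `k'Ω₀' = bΩ₀`, `ab = kk'`, `7 ∤ kk'`; `r = n₂k/(n_W a)`).  No CM input. [cite: SilvermanAEC2009, Thm. VI.4.1 (b) and C.16]
[cite: SilvermanATAEC1994, IV.5.1 with IV.6.1 and Cor. IV.9.1] -/
theorem exists_realPeriodRat_ratio {W W₂ : WeierstrassCurve ℚ} [W.IsElliptic] [W₂.IsElliptic] [W.IsGloballyMinimal]
    [W₂.IsGloballyMinimal] (φ₀ : Isogeny W W₂) (ψ₀ : Isogeny W₂ W) {e : ℤ} (he : e = 1 ∨ e = 2)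
    (hψφ : ∀ P, ψ₀ (φ₀ P) = e • P) (hφψ : ∀ Q, φ₀ (ψ₀ Q) = e • Q) :
    ∃ r : ℚ, (r : ℝ) * W.realPeriodRat = W₂.realPeriodRat ∧ padicValRat 7 r = 0 := by
  haveI : Fact (Nat.Prime 7) := ⟨by norm_num⟩
  haveI : (W.baseChange ℂ).IsElliptic := by rw [WeierstrassCurve.baseChange]; infer_instance
  haveI : (W₂.baseChange ℂ).IsElliptic := by rw [WeierstrassCurve.baseChange]; infer_instance
  obtain ⟨L, hL⟩ := exists_isNeronLatticeOf_holds (W.baseChange ℂ)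
  obtain ⟨L₂, hL₂⟩ := exists_isNeronLatticeOf_holds (W₂.baseChange ℂ)
  obtain ⟨k, hk0, hkd, hkΛ⟩ := exists_int_scaling hL hL₂ φ₀
  obtain ⟨k', hk0', hkd', hk'Λ⟩ := exists_int_scaling hL₂ hL ψ₀
  have h7k : ¬ (7 : ℤ) ∣ k := fun h ↦ not_seven_dvd_degree φ₀ ψ₀ he hψφ (h.trans hkd)
  have h7k' : ¬ (7 : ℤ) ∣ k' := fun h ↦ not_seven_dvd_degree ψ₀ φ₀ he hφψ (h.trans hkd')
  have hR : L.IsReal := isReal_neron hL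
  have hR₂ : L₂.IsReal := isReal_neron hL₂
  have hm : 0 < L.minRealPeriod := hR.minRealPeriod_pos
  have hm₂ : 0 < L₂.minRealPeriod := hR₂.minRealPeriod_pos
  -- `k Ω₀ = a Ω₀₂`, `k' Ω₀₂ = b Ω₀`
  obtain ⟨a, ha⟩ := hR₂.exists_eq_int_mul (t := k * L.minRealPeriod) (by
    have h := hkΛ _ hR.minRealPeriod_mem_lattice
    push_cast
    exact h)
  obtain ⟨b, hb⟩ := hR.exists_eq_int_mul (t := k' * L₂.minRealPeriod) (by
    have h := hk'Λ _ hR₂.minRealPeriod_mem_lattice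
    push_cast
    exact h)
  have hab : (a : ℝ) * b = k * k' := by
    have h1 : ((k : ℝ) * L.minRealPeriod) * ((k' : ℝ) * L₂.minRealPeriod) =
        ((a : ℝ) * L₂.minRealPeriod) * ((b : ℝ) * L.minRealPeriod) := by rw [ha, hb]
    have h2 : ((k : ℝ) * k' - a * b) * (L.minRealPeriod * L₂.minRealPeriod) = 0 := by linear_combination h1
    rcases mul_eq_zero.mp h2 with h3 | h3
    · linarith
    · exact absurd h3 (mul_pos hm hm₂).ne'
  have hab' : a * b = k * k' := by exact_mod_cast hab
  have ha0 : a ≠ 0 := by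
    rintro rfl
    simp only [Int.cast_zero, zero_mul] at ha
    rcases mul_eq_zero.mp ha with h | h
    · exact hk0 (by exact_mod_cast h)
    · exact hm.ne' h
  have h7a : ¬ (7 : ℤ) ∣ a := by
    intro h
    have h' : (7 : ℤ) ∣ k * k' := by rw [← hab']; exact dvd_mul_of_dvd_left h b
    rcases prime_seven_int.dvd_or_dvd h' with h'' | h''
    · exact h7k h''
    · exact h7k' h''
  -- the two real periods
  have hΩ : W.realPeriodRat = (W.baseChange ℝ).numRealComponents * L.minRealPeriod := realPeriodRat_eq hL
  have hΩ₂ : W₂.realPeriodRat = (W₂.baseChange ℝ).numRealComponents * L₂.minRealPeriod := realPeriodRat_eq hL₂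
  have hn0 : ((W.baseChange ℝ).numRealComponents : ℚ) ≠ 0 := by
    exact_mod_cast (W.baseChange ℝ).numRealComponents_pos.ne'
  have hn₂0 : ((W₂.baseChange ℝ).numRealComponents : ℚ) ≠ 0 := by
    exact_mod_cast (W₂.baseChange ℝ).numRealComponents_pos.ne'
  have hk0q : (k : ℚ) ≠ 0 := by exact_mod_cast hk0
  have ha0q : (a : ℚ) ≠ 0 := by exact_mod_cast ha0
  refine ⟨((W₂.baseChange ℝ).numRealComponents * k) / ((W.baseChange ℝ).numRealComponents * a), ?_, ?_⟩
  · rw [hΩ, hΩ₂]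
    have ha0r : (a : ℝ) ≠ 0 := by exact_mod_cast ha0
    have hn0r : ((W.baseChange ℝ).numRealComponents : ℝ) ≠ 0 := by
      exact_mod_cast (W.baseChange ℝ).numRealComponents_pos.ne'
    have hkm : L₂.minRealPeriod = (k : ℝ) * L.minRealPeriod / a := by
      rw [ha, mul_div_cancel_left₀ _ ha0r]
    rw [hkm]
    push_cast
    field_simp
  · rw [padicValRat.div (mul_ne_zero hn₂0 hk0q) (mul_ne_zero hn0 ha0q), padicValRat.mul hn₂0 hk0q,
      padicValRat.mul hn0 ha0q, padicValRat_numRealComponents, padicValRat_numRealComponents,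
      padicValRat.of_int, padicValRat.of_int, padicValInt.eq_zero_of_not_dvd h7k, padicValInt.eq_zero_of_not_dvd h7a]
    simp

/-! ## §4 The CM field block: `d_Kcm = −7`, `Λ₋₇ = ι₀(𝓞 Kcm)`, the norm of `√−7` -/

section CMField

variable {Kcm : Type} [Field Kcm] [NumberField Kcm]

/-- **`cmRing(−7) = ι₀(𝓞 Kcm)`** for the pin's field (`[Kcm : ℚ] = 2`, `s² = −7`; `d_K = −7 ≡ 1 mod 4`, Cox (5.14)/(7.1)).
[cite: Cox2013, §5.B eq. (5.14) and §7.A eq. (7.1)] -/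
theorem mem_cmRing_neg_seven_iff (h2 : Module.finrank ℚ Kcm = 2) (s : 𝓞 Kcm) (hs : (s : Kcm) ^ 2 = -7) (ι₀ : Kcm →+* ℂ)
    (z : ℂ) : z ∈ cmRing (-7) ↔ ∃ a : 𝓞 Kcm, ι₀ (a : Kcm) = z := by
  have hKiq : IsImaginaryQuadratic Kcm := isImaginaryQuadratic_of_sq h2 hs
  have hdisc : NumberField.discr Kcm = -7 := discr_eq_neg_seven h2 hs
  have h := exists_forall_mem_cmRing_discr_iff hKiq (by rw [hdisc]; decide) ι₀ z
  rwa [hdisc] at h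

/-- **`z ∈ Ω·Λ₋₇ ↔ ∃ a : 𝓞 Kcm, z = Ω·ι₀ a`** (the lattice clause of the letter, for any lattice presented as `Ω·Λ₋₇`).
[cite: Cox2013, §7.A eq. (7.1)] [cite: CoatesWiles1977, §1 p. 225] -/
theorem mem_lattice_iff_of_eq_mulLeft (h2 : Module.finrank ℚ Kcm = 2) (s : 𝓞 Kcm) (hs : (s : Kcm) ^ 2 = -7) (ι₀ : Kcm →+* ℂ)
    {L : PeriodPair} {Ω : ℂ} {hΩ : Ω ≠ 0} (hlat : L.lattice = ((cmPeriodPair (-7)).mulLeft Ω hΩ).lattice) (z : ℂ) :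
    z ∈ L.lattice ↔ ∃ a : 𝓞 Kcm, z = Ω * ι₀ (a : Kcm) := by
  rw [hlat, PeriodPair.mem_mulLeft_lattice, ← SetLike.mem_coe,
    coe_cmPeriodPair_lattice (d := -7) (c := 14) (by norm_num) (by norm_num), SetLike.mem_coe,
    mem_cmRing_neg_seven_iff h2 s hs ι₀]
  constructor
  · rintro ⟨a, ha⟩
    exact ⟨a, by rw [ha, ← mul_assoc, mul_inv_cancel₀ hΩ, one_mul]⟩
  · rintro ⟨a, rfl⟩
    exact ⟨a, by rw [← mul_assoc, inv_mul_cancel₀ hΩ, one_mul]⟩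

/-- `(N s)² = N(−7) = 49` for `s² = −7`, hence **`v₇(N s) = 1`**. [cite: Cox2013, §7.A eq. (7.1) (the norm form)] -/
theorem padicValRat_norm_sqrt (h2 : Module.finrank ℚ Kcm = 2) (s : 𝓞 Kcm) (hs : (s : Kcm) ^ 2 = -7) :
    padicValRat 7 (Algebra.norm ℚ (s : Kcm)) = 1 := by
  haveI : Fact (Nat.Prime 7) := ⟨by norm_num⟩
  have h : (Algebra.norm ℚ (s : Kcm)) ^ 2 = 7 ^ 2 := by
    rw [← map_pow, hs, show (-7 : Kcm) = algebraMap ℚ Kcm (-7) by simp, Algebra.norm_algebraMap, h2]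
    norm_num
  have h7 : padicValRat 7 (7 : ℚ) = 1 := by exact_mod_cast padicValRat.self (p := 7) (by norm_num)
  have hv := congrArg (padicValRat 7) h
  rw [padicValRat.pow, padicValRat.pow, h7] at hv
  push_cast at hv
  linarith

/-- `N a ∈ ℤ` for `a ∈ 𝓞 Kcm`, so **`v₇(N a) ≥ 0`**. [cite: Cox2013, §7.A eq. (7.1) (the norm form)] -/
theorem padicValRat_norm_integer_nonneg (a : 𝓞 Kcm) : 0 ≤ padicValRat 7 (Algebra.norm ℚ (a : Kcm)) := by
  rw [← Algebra.coe_norm_int, padicValRat.of_int]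
  positivity

end CMField

end LatticeTypeLaw

end Summit.BirchSwinnertonDyer.Rank1Residual.Additive.GenusSeven

end
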